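import Summits.BirchSwinnertonDyer.BirchSwinnertonDyer.Theorems.ByReductionTypeAtTwoRankOneAtTwoOffBigImageOddLocalEngineCyclotomic
import HarnessLib

/-!
# Route `ByReductionTypeAtTwo`, crux `RankOneAtTwoOffBigImageOddLocal` (stmt-BirchSwinnertonDyer-23716), line
# `refined_kolyvagin_tamagawa_shift_at_two` — ENGINE PORT `c₀ ↦ h₀` (regular element), §E (cont.) basis glue: determinant `−1` ⟹ inverts `μ`

Lead prover `prover-cruxlead-stmt-BirchSwinnertonDyer-23716-g0` (2026-08-28), landing the crux-plan g6 ENGINE QUARRY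
`Cruxes/RankOneAtTwoOffBigImageOddLocal/RefinedKolyvaginEngineG6.lean` (planner `cruxplan-…-23716-refined-kolyvag-9ff2fe475f-g6`, v4, 1631 lines,
rc 0 / 0 sorry; `Cruxes/` files are not importable, so the lead COPIES the proofs into `Theorems/` — card «LEAD QUICKSTART (g6)» Q2 #3 / Q4) as
`--supports stmt-BirchSwinnertonDyer-23716` helpers.  The engine port is kernel-closable item #3 of the pen's order (PEN-PICK-23716 ADD-4): replace
complex conjugation `c₀` by a REGULAR element `h₀` (det `−1`, trace `0`, odd mod `2`) in the tree's equivariant-Čebotarev engine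
`GenusExact.exists_kolyvaginPrime_gt_two_of_galoisElement`, so that Kolyvagin primes with LOSSLESS local Kummer maps exist on the `Δ > 0` cells of the
S₃-locus (where `ρ̄₂(c₀) = 1` loses the top bit — residual 24883), feeding the line's filtered stubs `…WithOn Φ_reg Ω` (card #7
`regular-frobenius-kolyvagin-primes-pos-disc`).  THIS FILE: §E part 2 — `smul_eq_inv_of_det_repr_eq_neg_one` (determinant `−1` in a `ZMod p^{n+1}`-basis of `E[p^{n+1}]` ⟹ the element inverts `μ_{p^{n+1}}`), `smul_eq_self_of_smul_basis_eq_self` (fixing a basis ⟹ fixing `μ`), with the basis bookkeeping `zmod_smul_eq_val_nsmul`, `exists_nsmul_add_nsmul_of_basis`, `pow_nsmul_basis_ne_zero`, `smul_smul_eq_self_of_basis`.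

Statements and proofs are the quarry's VERBATIM (namespace moved to `…Theorems.OffBigImageOddLocalAtTwo.Engine`).  Nothing here proves the crux,
`BSDp W 2`, BSD or the summit; no registered stub is discharged (engine inputs only).  BSD is not proved.

Refs: [GrossLMS1991] §3 (3.1)–(3.3), §9; [McCallumLMS1991] §3; [SilvermanAEC2009] III.§1, III.§8 (Weil pairing), VII–VIII; Dokchitser–Dokchitser (2012);
Serre (1972) §5.3.
-/

set_option linter.dupNamespace false -- tree convention: `Summit.BirchSwinnertonDyer.BirchSwinnertonDyer.Theorems` (summit = sub-problem)
set_option autoImplicit false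

noncomputable section

namespace Summit.BirchSwinnertonDyer.BirchSwinnertonDyer.Theorems.OffBigImageOddLocalAtTwo.Engine

/-! ## §E  The (3.3) port: complex conjugation ↦ any element inverting `μ` (PROVED; card ENGINE-PORT MAP step E0)

The tree's `FrobEqFrobInfty`-consumers use `IsComplexConjugation c₀` only through (i) `c₀` inverts roots of unity
(`RatClosure.smul_eq_inv_of_pow_eq_one`), (ii) `c₀² = 1`, (iii) `c₀|_K = τ`.  For the line's regular element `h₀`
(`det ρ(h₀) = -1`, `ρ_{2^{M+1}}(h₀)² = 1`, `h₀|_K = τ`, but `h₀² ≠ 1` in `Γ_ℚ`) this section re-proves the (3.3)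
consequences from exactly those properties:
`smul_eq_inv_of_smul_torsion_eq_of_inverts` (tree `smul_eq_inv_of_smul_torsion_pow_eq` with (i) as hypothesis),
`pow_dvd_add_one_of_frob_smul_eq_of_inverts` (`p^M ∣ ℓ + 1`), `pow_dvd_frobeniusTraceAt_of_frob_smul_eq_of_inverts`
(`p^M ∣ a_ℓ`, with (ii) as the hypothesis `∀ P, c₀ • c₀ • P = P` on `E[p^M]` only), and the CONVERSE Weil-pairing algebra
supplying (i) from a matrix: `pairing_lin_comb` (`e(aS+cT, bS+dT)·e(S,T)^{bc} = e(S,T)^{ad}`), `pairing_eq_inv_of_det_eq_neg_one`,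
`pairing_isPrimitiveRoot_of_span`, basis glue (`eq_nsmul_add_nsmul_of_basis`, `natCast_val_det_eq_of_det_eq_neg_one`,
`pow_nsmul_basis_ne_zero`, `smul_smul_eq_self_of_basis`) and the capstone `smul_eq_inv_of_det_repr_eq_neg_one`:
**`det (b.repr (σ • b j) i) = -1` for a `ZMod p^{n+1}`-basis `b` of `E[p^{n+1}]` ⟹ `σ • ζ = ζ⁻¹` for every `ζ ∈ μ_{p^{n+1}}`.**
-/

section CyclotomicE

open scoped Classical
open WeierstrassCurve NumberField IsDedekindDomain Field
open Literature.NumberTheory.GaloisRepresentations Literature.NumberTheory.EllipticCurves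

/-! ### E0 glue: from a `ZMod q`-basis of `E[q]` to the ℕ-coefficient hypotheses above -/

section BasisGlue

variable {q : ℕ} [NeZero q] {V : Type*} [AddCommGroup V] [Module (ZMod q) V]

/-- A `ZMod q`-scalar acts as its representative natural number. [folklore] -/
theorem zmod_smul_eq_val_nsmul (r : ZMod q) (v : V) : r • v = r.val • v := by
  conv_lhs => rw [← ZMod.natCast_zmod_val r]
  exact Nat.cast_smul_eq_nsmul (ZMod q) r.val v

/-- Coordinates in a basis `(b 0, b 1)` as natural-number multiples (for `pairing_lin_comb` / `hspan`). -/
theorem eq_nsmul_add_nsmul_of_basis (b : Module.Basis (Fin 2) (ZMod q) V) (X : V) :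
    X = (b.repr X 0).val • b 0 + (b.repr X 1).val • b 1 := by
  conv_lhs => rw [← b.sum_repr X]
  rw [Fin.sum_univ_two, zmod_smul_eq_val_nsmul, zmod_smul_eq_val_nsmul]

/-- Every vector is an ℕ-combination of a two-element `ZMod q`-basis. [folklore] -/
theorem exists_nsmul_add_nsmul_of_basis (b : Module.Basis (Fin 2) (ZMod q) V) (X : V) :
    ∃ i j : ℕ, X = i • b 0 + j • b 1 :=
  ⟨_, _, eq_nsmul_add_nsmul_of_basis b X⟩

/-- `det = -1` in `ZMod q` ⟹ the ℕ-exponent congruence `ad + 1 ≡ bc (mod q)` used by `pairing_eq_inv_of_det_eq_neg_one`. -/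
theorem natCast_val_det_eq_of_det_eq_neg_one (A B C D : ZMod q) (h : A * D - B * C = -1) :
    ((A.val * D.val + 1 : ℕ) : ZMod q) = ((B.val * C.val : ℕ) : ZMod q) := by
  simp only [Nat.cast_add, Nat.cast_mul, Nat.cast_one, ZMod.natCast_zmod_val]
  linear_combination h

end BasisGlue

/-- A basis vector of a free `ZMod p^{n+1}`-module has exact order `p^{n+1}`: `p^n • b i ≠ 0` (the `hT` of
`pairing_isPrimitiveRoot_of_span`). -/
theorem pow_nsmul_basis_ne_zero {p n : ℕ} [hp : Fact p.Prime] {V ι : Type*} [AddCommGroup V]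
    [Module (ZMod (p ^ (n + 1))) V] (b : Module.Basis ι (ZMod (p ^ (n + 1))) V) (i : ι) : p ^ n • b i ≠ 0 := by
  haveI : NeZero (p ^ (n + 1)) := ⟨pow_ne_zero _ hp.out.ne_zero⟩
  intro h
  have h1 := congrArg (fun v ↦ b.repr v i) h
  simp only [map_zero, Finsupp.zero_apply] at h1
  rw [← Nat.cast_smul_eq_nsmul (ZMod (p ^ (n + 1))), map_smul, b.repr_self, Finsupp.smul_apply,
    Finsupp.single_eq_same, smul_eq_mul, mul_one] at h1
  have h2 := congrArg ZMod.val h1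
  rw [ZMod.val_natCast, ZMod.val_zero,
    Nat.mod_eq_of_lt (Nat.pow_lt_pow_right hp.out.one_lt (Nat.lt_succ_self n))] at h2
  exact pow_ne_zero _ hp.out.ne_zero h2

/-- **Inverting one primitive `q`-th root of unity inverts them all** (for the Galois action on `ℚ̄`). -/
theorem smul_eq_inv_of_smul_primitiveRoot_eq_inv {q : ℕ} {x : AlgebraicClosure ℚ} (hx : IsPrimitiveRoot x q)
    (hq : q ≠ 0) {σ : absoluteGaloisGroup ℚ} (hσ : σ • x = x⁻¹) (ζ : AlgebraicClosure ℚ) (hζ : ζ ^ q = 1) :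
    σ • ζ = ζ⁻¹ := by
  haveI : NeZero q := ⟨hq⟩
  obtain ⟨k, -, rfl⟩ := hx.eq_pow_of_pow_eq_one hζ
  rw [smul_pow', hσ, inv_pow]

/-- **E0 CAPSTONE — `det ρ_{p^{n+1}}(σ) = -1` in a basis of `E[p^{n+1}]` ⟹ `σ` inverts `μ_{p^{n+1}}`** (Weil pairing: `det ρ = χ_cyc`;
the converse of the tree's `toZModPow_det_galoisRepTate_eq`).  This is the hypothesis `hc₀` of `smul_eq_inv_of_smul_torsion_eq_of_inverts`
/ `pow_dvd_add_one_of_frob_smul_eq_of_inverts` for the line's regular element `c₀ = h₀` (E1 supplies `ρ_{2^{M+1}}(h₀)` of determinant `-1`).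
Any `ZMod`-module structure on `E[p^{n+1}]` (the tree uses `AddSubgroup.torsionBy.zmodModule` via `letI`) may be supplied. -/
theorem smul_eq_inv_of_det_repr_eq_neg_one (W : WeierstrassCurve ℚ) [W.IsElliptic] {p : ℕ} (hp : p.Prime) (n : ℕ)
    [Module (ZMod (p ^ (n + 1))) (geomTorsion W ((p ^ (n + 1) : ℕ) : ℤ))]
    (b : Module.Basis (Fin 2) (ZMod (p ^ (n + 1))) (geomTorsion W ((p ^ (n + 1) : ℕ) : ℤ)))
    {σ : absoluteGaloisGroup ℚ}
    (hdet : b.repr (σ • b 0) 0 * b.repr (σ • b 1) 1 - b.repr (σ • b 1) 0 * b.repr (σ • b 0) 1 = -1)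
    (ζ : AlgebraicClosure ℚ) (hζ : ζ ^ (p ^ (n + 1)) = 1) : σ • ζ = ζ⁻¹ := by
  haveI : Fact p.Prime := ⟨hp⟩
  have hq0 : p ^ (n + 1) ≠ 0 := pow_ne_zero _ hp.ne_zero
  haveI : NeZero (p ^ (n + 1)) := ⟨hq0⟩
  have hq2 : 2 ≤ p ^ (n + 1) :=
    le_trans hp.two_le (by
      calc p = p ^ 1 := (pow_one p).symm
        _ ≤ p ^ (n + 1) := Nat.pow_le_pow_right hp.pos (by omega))
  obtain ⟨e, hpow, hadd₁, hadd₂, halt, hnd, hgal⟩ :=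
    W.exists_weilPairing_holds (p ^ (n + 1)) hq2 (by exact_mod_cast hq0)
  have hS := eq_nsmul_add_nsmul_of_basis b (σ • b 0)
  have hT := eq_nsmul_add_nsmul_of_basis b (σ • b 1)
  have hdet' := natCast_val_det_eq_of_det_eq_neg_one _ _ _ _ hdet
  have hinv : e (σ • b 0) (σ • b 1) = (e (b 0) (b 1))⁻¹ :=
    pairing_eq_inv_of_det_eq_neg_one e hq0 hpow hadd₁ hadd₂ halt (b 0) (b 1) _ _ _ _ hdet' hS hT
  have hσx : σ • e (b 0) (b 1) = (e (b 0) (b 1))⁻¹ := by rw [hgal, hinv]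
  have hprim : IsPrimitiveRoot (e (b 0) (b 1)) (p ^ (n + 1)) :=
    pairing_isPrimitiveRoot_of_span e hpow hadd₁ hadd₂ halt hnd (b 0) (b 1)
      (exists_nsmul_add_nsmul_of_basis b) (pow_nsmul_basis_ne_zero b 1)
  exact smul_eq_inv_of_smul_primitiveRoot_eq_inv hprim hq0 hσx ζ hζ

/-- `σ² = 1` on `E[q]` from its values on a basis (the `hc₀sq` of `pow_dvd_frobeniusTraceAt_of_frob_smul_eq_of_inverts` from
`ρ_q(c₀)² = 1`). -/
theorem smul_smul_eq_self_of_basis {q : ℕ} [NeZero q] {G V : Type*} [Monoid G] [AddCommGroup V] [DistribMulAction G V]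
    [Module (ZMod q) V] (b : Module.Basis (Fin 2) (ZMod q) V) {σ : G} (h0 : σ • σ • b 0 = b 0)
    (h1 : σ • σ • b 1 = b 1) (P : V) : σ • σ • P = P := by
  obtain ⟨i, j, rfl⟩ := exists_nsmul_add_nsmul_of_basis b P
  have key : ∀ x : V, σ • σ • x = (DistribSMul.toAddMonoidHom V σ) ((DistribSMul.toAddMonoidHom V σ) x) :=
    fun _ ↦ rfl
  rw [key, map_add, map_add, map_nsmul, map_nsmul, map_nsmul, map_nsmul, ← key, ← key, h0, h1]

/-- **An element fixing a basis of `E[p^{n+1}]` fixes `μ_{p^{n+1}}`** (Weil pairing; used to propagate the inverting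
hypothesis `hμ` from `h₀` to `h₀ · res n`, `n ∈ Γ_{K(E[2^M])}`: `(h₀ n) • ζ = h₀ • ζ`). -/
theorem smul_eq_self_of_smul_basis_eq_self (W : WeierstrassCurve ℚ) [W.IsElliptic] {p : ℕ} (hp : p.Prime) (n : ℕ)
    [Module (ZMod (p ^ (n + 1))) (geomTorsion W ((p ^ (n + 1) : ℕ) : ℤ))]
    (b : Module.Basis (Fin 2) (ZMod (p ^ (n + 1))) (geomTorsion W ((p ^ (n + 1) : ℕ) : ℤ)))
    {σ : absoluteGaloisGroup ℚ} (h0 : σ • b 0 = b 0) (h1 : σ • b 1 = b 1)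
    (ζ : AlgebraicClosure ℚ) (hζ : ζ ^ (p ^ (n + 1)) = 1) : σ • ζ = ζ := by
  haveI : Fact p.Prime := ⟨hp⟩
  have hq0 : p ^ (n + 1) ≠ 0 := pow_ne_zero _ hp.ne_zero
  haveI : NeZero (p ^ (n + 1)) := ⟨hq0⟩
  have hq2 : 2 ≤ p ^ (n + 1) :=
    le_trans hp.two_le (by
      calc p = p ^ 1 := (pow_one p).symm
        _ ≤ p ^ (n + 1) := Nat.pow_le_pow_right hp.pos (by omega))
  obtain ⟨e, hpow, hadd₁, hadd₂, halt, hnd, hgal⟩ :=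
    W.exists_weilPairing_holds (p ^ (n + 1)) hq2 (by exact_mod_cast hq0)
  have hσx : σ • e (b 0) (b 1) = e (b 0) (b 1) := by rw [hgal, h0, h1]
  have hprim : IsPrimitiveRoot (e (b 0) (b 1)) (p ^ (n + 1)) :=
    pairing_isPrimitiveRoot_of_span e hpow hadd₁ hadd₂ halt hnd (b 0) (b 1)
      (exists_nsmul_add_nsmul_of_basis b) (pow_nsmul_basis_ne_zero b 1)
  obtain ⟨k, -, rfl⟩ := hprim.eq_pow_of_pow_eq_one hζ
  rw [smul_pow', hσx]

end CyclotomicE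

end Summit.BirchSwinnertonDyer.BirchSwinnertonDyer.Theorems.OffBigImageOddLocalAtTwo.Engine

end
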